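import Summits.QuantumFields.YangMills.Theorems.SmallCircleAnchorAnchorGapStaticGauge
import Summits.QuantumFields.YangMills.Theorems.SmallCircleAnchorAnchorGapGaugeCovariance

/-!
# Static gauge for the pinned finite-temperature Wilson expectation of crux `AnchorGap`

Helper for crux stmt-QuantumFields-11141 (`AnchorGap`, route `SmallCircleAnchor`), line
independent (first step of `stub_abelianisation`): `static_gauge_Ex` — in the crux's inline
vocabulary (pinning strength a free real `s`), the expectation of every measurable
GAUGE-INVARIANT observable `F` may be computed with all time-like links outside the top time
layer set to `1` in BOTH the observable and the weight:
`Ex F = (∫ F (kill U) wgt (kill U) dν) / (∫ wgt (kill U) dν)`. In the killed configuration the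
Polyakov line above `x` is the single top-layer link `U ((-1, x), none)` (an independent
Haar-distributed holonomy field), the electric plaquettes of the lower layers are the
Kaluza–Klein hopping terms `Re tr r(W_{t+1} W_t⁻¹)` and those of the top layer carry the adjoint
holonomy coupling — the static-gauge / gauge–adjoint-Higgs presentation used by every treatment
of the Polyakov mechanism (Borgs–Seiler 1983 §II; `T = 1`: the one-layer model). Ingredients:
`StaticGauge.static_gauge_integral` (p152584) applied to `F · wgt` and to `wgt`, gauge
invariance of the pinned weight (`GaugeAvg.soft_weight_gauge_invariant`).
-/

set_option autoImplicit false

noncomputable section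

namespace Summit.QuantumFields.YangMills.Theorems.AnchorGap

open MeasureTheory
open Literature.MathematicalPhysics.QuantumFieldTheory

namespace StaticGauge

/-- **Static gauge for the pinned expectation** (crux `AnchorGap` vocabulary, registered
sub-goal; pinning strength a free real `s`): for every measurable gauge-invariant observable `F`,
`Ex F = (∫ F (kill U) · wgt (kill U) dν(U)) / (∫ wgt (kill U) dν(U))`, where `kill` sets every
time-like link `((t, x), none)` with `t + 1 ≠ 0` to `1`. Proof: `static_gauge_integral` for the
gauge-invariant measurable integrands `F · wgt` and `wgt` (the pinned weight is gauge invariant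
for every class function `V`, `soft_weight_gauge_invariant`; it is continuous, hence measurable on
the second-countable configuration space). [folklore] -/
theorem static_gauge_Ex :
    ∀ (G : Type) [Group G] [TopologicalSpace G] [IsTopologicalGroup G] [CompactSpace G], letI : MeasurableSpace G := borel G; haveI : BorelSpace G := ⟨rfl⟩; ∀ (r : LatticeRep G) (V : G → ℝ), (∀ a g : G, V (a * g * a⁻¹) = V g) → Continuous V → ∀ (T : ℕ) [NeZero T] (β s : ℝ) (L : ℕ) [NeZero L], let St := ZMod T × (Fin 3 → ZMod L); let Cfg := St × Option (Fin 3) → G; let ν : MeasureTheory.Measure Cfg := MeasureTheory.Measure.pi fun _ => haarProbability G; let sh : St → Option (Fin 3) → St := fun x μ => Option.elim μ (x.1 + 1, x.2) fun i => (x.1, x.2 + Pi.single i 1); let pl : Cfg → St → Option (Fin 3) → Option (Fin 3) → G := fun U x μ κ => U (x, μ) * U (sh x μ, κ) * (U (sh x κ, μ))⁻¹ * (U (x, κ))⁻¹; let act : Cfg → ℝ := fun U => β * ∑ x : St, ∑ i : Fin 3, (r.ρ (pl U x none (some i))).trace.re + β * ∑ x : St, ∑ q : {q : Fin 3 × Fin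 3 // q.1 < q.2}, (r.ρ (pl U x (some q.1.1) (some q.1.2))).trace.re; let P : Cfg → (Fin 3 → ZMod L) → G := fun U x => (List.ofFn fun t : Fin T => U ((((t : ℕ) : ZMod T), x), none)).prod; let wgt : Cfg → ℝ := fun U => Real.exp (act U - s * ∑ x : Fin 3 → ZMod L, V (P U x)); let Ex : (Cfg → ℝ) → ℝ := fun F => (∫ U, F U * wgt U ∂ν) / (∫ U, wgt U ∂ν); let gauge : (St → G) → Cfg → Cfg := fun h U p => h p.1 * U p * (h (sh p.1 p.2))⁻¹; let kill : Cfg → Cfg := fun U p => if p.2 = none ∧ p.1.1 + 1 ≠ 0 then 1 else U p; ∀ F : Cfg → ℝ, Measurable F → (∀ (h : St → G) (U : Cfg), F (gauge h U) = F U) → Ex F = (∫ U, F (kill U) * wgt (kill U) ∂ν) / (∫ U, wgt (kill U) ∂ν) := by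
  intro G _ _ _ _
  letI : MeasurableSpace G := borel G
  haveI : BorelSpace G := ⟨rfl⟩
  intro r V hVcl hVc T _ β s L _ St Cfg ν sh pl act P wgt Ex gauge kill F hFm hFg
  haveI : SecondCountableTopology G :=
    (r.continuous.isClosedEmbedding r.injective).isEmbedding.secondCountableTopology
  -- the weight: gauge invariant and measurable
  have hwginv : ∀ (h : St → G) (U : Cfg), wgt (gauge h U) = wgt U :=
    GaugeAvg.soft_weight_gauge_invariant G r V hVcl (fun _ => s) T β L
  have hplc : ∀ (x : St) (μ κ : Option (Fin 3)), Continuous fun U : Cfg => pl U x μ κ := by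
    intro x μ κ
    show Continuous fun U : Cfg => U (x, μ) * U (sh x μ, κ) * (U (sh x κ, μ))⁻¹ * (U (x, κ))⁻¹
    exact (((continuous_apply (x, μ)).mul (continuous_apply (sh x μ, κ))).mul
      (continuous_apply (sh x κ, μ)).inv).mul (continuous_apply (x, κ)).inv
  have htrc : ∀ (x : St) (μ κ : Option (Fin 3)),
      Continuous fun U : Cfg => (r.ρ (pl U x μ κ)).trace.re := fun x μ κ =>
    Complex.continuous_re.comp ((r.continuous.comp (hplc x μ κ)).matrix_trace)
  have hactc : Continuous act := by
    refine (continuous_const.mul (continuous_finsetSum _ fun x _ =>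
      continuous_finsetSum _ fun i _ => htrc x none (some i))).add
      (continuous_const.mul (continuous_finsetSum _ fun x _ =>
        continuous_finsetSum _ fun q _ => htrc x (some q.1.1) (some q.1.2)))
  have hPc : ∀ x : Fin 3 → ZMod L, Continuous fun U : Cfg => P U x := by
    intro x
    show Continuous fun U : Cfg => (List.ofFn fun t : Fin T => U ((((t : ℕ) : ZMod T), x), none)).prod
    simp only [List.ofFn_eq_map]
    exact continuous_list_prod _ fun t _ => continuous_apply _
  have hwc : Continuous wgt :=
    Real.continuous_exp.comp (hactc.sub (continuous_const.mul
      (continuous_finsetSum _ fun x _ => hVc.comp (hPc x))))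
  have key := static_gauge_integral G T L
  have e1 := key (fun U => F U * wgt U) (hFm.mul hwc.measurable) fun h U => by
    show F (gauge h U) * wgt (gauge h U) = F U * wgt U
    rw [hFg, hwginv]
  have e2 := key wgt hwc.measurable hwginv
  exact congrArg₂ (fun a b : ℝ => a / b) e1 e2

end StaticGauge

end Summit.QuantumFields.YangMills.Theorems.AnchorGap

end
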